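import Summits.KontsevichZagierPeriods.KontsevichZagierPeriods.Theorems.RootDecompRationalCubeDichotomyEtaleInnerResidue

/-!
# Route RootDecompRationalCubeDichotomy — items 29429 `PiRationalisationEtale` / 29431 `PiRationalisationGlue` PROVED, part 6/8: the weighted pole contribution `poleContributionE`, `boxChainE_of` / `boxChainE_holds`, the closed-cube composition `etale_cube` and the box-map transport lemmas (`RootDecompRationalCubeDichotomyEtalePoleBox`)

Theorems-split (≤ 400 lines each, sequential imports) of the decomp-kz lens-2 gen-5 file
`run/shared/lean/pub/decomp-kz/decomp-kz-lens-2/g5/PiRationalisationEtale.lean` (sha256 204f4992…, 2557 lines; lens farm rc 0 / 0 sorry /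
std axioms; critic decomp-kz-crit-1 g2 CLEARED/CONFIRMED 2026-08-30T06:50:50Z «29429 + 29431 proved BY NAME»), landed by the census seat
decomp-kz-census-1 g6 with the 86 verbatim copies of already-landed declarations REMOVED in favour of `import`/`open` of the landed
`Rung27842.ReIm` / `Rung27842.SimpleBranch` / `Rung24903` chain (`ratCubeSet`, `piIter_mem_sup`, `RatBoxSet`, `BoxRescale`, `boxRescale_holds`,
the Re–Im polynomial calculus, the Green assembly kit, the S3/S1 lemmas), so that only the NEW weighted (étale) content is declared here.
The rung: for WEIGHTED simple-branch (standard-étale) data `[Π[loᵢ,hiᵢ], A(x,h x)/B(x,h x)]` (`F(x,h) = 0`, `∂_w F(x,h) ≠ 0`, `B(x,h) ≠ 0` on the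
closed box, `F A B ∈ ℚ[x,w]`, `h` ℚ-Nash near the box) `[π]^K·[s] ∈ relations ⊔ ⟨rational closed-cube sector⟩` for every `K ≥ 1` — the gen-4
argument-principle chain with the contour form `ω = A·F_w/(B·F) dw`, whose residue at the simple real root is `A/B = s.integrand`.
[Kontsevich–Zagier 2001 §1.2; argument principle] Standard axioms, 0 sorry.
-/

noncomputable section

set_option linter.dupNamespace false

namespace Summit.KontsevichZagierPeriods.RootDecompRationalCubeDichotomy.RungEtale.Etale

open MeasureTheory Set MvPolynomial
open Literature.NumberTheory.Transcendental Literature.NumberTheory.Transcendental.KZ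
open Literature.ModelTheory.ExponentialFields (IsSemialgebraic analyticOnNhd_aeval continuous_aeval_real)
open Summit.KontsevichZagierPeriods.KontsevichZagierPeriods.Theses.RootDecompRationalCubeDichotomy
open Summit.KontsevichZagierPeriods.RootDecompRationalCubeDichotomy.Rung24903 (of_sub_of_mem_relations_of_fibreMap)
open Summit.KontsevichZagierPeriods.RootDecompRationalCubeDichotomy.Rung27842
open Summit.KontsevichZagierPeriods.RootDecompRationalCubeDichotomy.Rung27842.RootIso
open Summit.KontsevichZagierPeriods.RootDecompRationalCubeDichotomy.Rung27842.SimpleBranch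
open Summit.KontsevichZagierPeriods.RootDecompRationalCubeDichotomy.Rung24903
  (piRep_mul_mem_sup_of_mem_closure piRep_mul_mem_sup piIter_mem_sup isSemialgebraic_cubeLit)

/-- **The pole contribution is `[π]·[D, φ]` (gen 5 weighted form: weight `φ = sg.integrand`, pole at the simple
root `g`).** `P₁ = [D, φ] × V` on the nose, `P₂ ≅ [D, φ] × T` by the fibred translation `u ↦ u − g(x)`,
`[T] + [V] ≡ [π]` (half winding number, landed `Rung27842.halfWinding`), and the commutator. Adapted from the landed
`Rung27842.poleContribution` (where `φ = g`). [this node; Kontsevich–Zagier 2001 §1.2 rules 1)–2), §4.1] -/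
theorem poleContributionE {n : ℕ} (ε : ℚ) (hε : 0 < ε) {D : Set (Fin n → ℝ)} (g : (Fin n → ℝ) → ℝ)
    (hg : IsSemialgebraicFunOn ℚ D g) (hgd : ∀ x ∈ D, DifferentiableAt ℝ g x)
    (sg : IntegralRep n) (hsgd : sg.domain = D)
    (P₁ P₂ : IntegralRep (n + 1))
    (hP₁d : P₁.domain = KZlog.band D (fun _ => 0) (fun _ => (ε:ℝ)))
    (hP₁i : ∀ z ∈ P₁.domain,
      P₁.integrand z = 2 * sg.integrand (Fin.init z) * (ε:ℝ) / ((ε:ℝ) ^ 2 + z (Fin.last n) ^ 2))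
    (hP₂d : P₂.domain = KZlog.band D (fun x => g x - ε) (fun x => g x + ε))
    (hP₂i : ∀ z ∈ P₂.domain,
      P₂.integrand z = sg.integrand (Fin.init z) * (ε:ℝ) / ((z (Fin.last n) - g (Fin.init z)) ^ 2 + (ε:ℝ) ^ 2)) :
    of P₁ + of P₂ - of piRep * of sg ∈ relations := by
  have hε' : (0:ℝ) < ε := by exact_mod_cast hε
  -- the two one-dimensional representations of the half winding number
  have hTsa : IsSemialgebraic ℚ {u : Fin 1 → ℝ | -(ε:ℝ) ≤ u 0 ∧ u 0 ≤ (ε:ℝ)} := by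
    simpa [Rat.cast_neg] using isSemialgebraic_interval (-ε) ε
  have hVsa : IsSemialgebraic ℚ {u : Fin 1 → ℝ | 0 ≤ u 0 ∧ u 0 ≤ (ε:ℝ)} := by
    simpa using isSemialgebraic_interval 0 ε
  have hTf : IsSemialgebraicFunOn ℚ {u : Fin 1 → ℝ | -(ε:ℝ) ≤ u 0 ∧ u 0 ≤ (ε:ℝ)}
      (fun u => (ε:ℝ) / (u 0 ^ 2 + (ε:ℝ) ^ 2)) := by
    refine (isSemialgebraicFunOn_aeval_div_aeval hTsa (C ε) (X 0 ^ 2 + C ε ^ 2) fun u _ => ?_).congr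
      fun u _ => ?_
    · simp only [map_add, map_pow, MvPolynomial.aeval_X, MvPolynomial.aeval_C, eq_ratCast]; positivity
    · simp only [map_add, map_pow, MvPolynomial.aeval_X, MvPolynomial.aeval_C, eq_ratCast]
  have hTc : ContinuousOn (fun u : Fin 1 → ℝ => (ε:ℝ) / (u 0 ^ 2 + (ε:ℝ) ^ 2))
      {u : Fin 1 → ℝ | -(ε:ℝ) ≤ u 0 ∧ u 0 ≤ (ε:ℝ)} :=
    (continuous_const.div (by fun_prop) fun u => by positivity).continuousOn
  let T : IntegralRep 1 := contRep _ hTsa isCompact_slab₁.1 _ hTf hTc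
  have hVf : IsSemialgebraicFunOn ℚ {u : Fin 1 → ℝ | 0 ≤ u 0 ∧ u 0 ≤ (ε:ℝ)}
      (fun v => 2 * (ε:ℝ) / ((ε:ℝ) ^ 2 + v 0 ^ 2)) := by
    refine (isSemialgebraicFunOn_aeval_div_aeval hVsa (C (2:ℚ) * C ε) (C ε ^ 2 + X 0 ^ 2) fun u _ => ?_).congr
      fun u _ => ?_
    · simp only [map_add, map_pow, MvPolynomial.aeval_X, MvPolynomial.aeval_C, eq_ratCast]; positivity
    · simp only [map_add, map_mul, map_pow, MvPolynomial.aeval_X, MvPolynomial.aeval_C, eq_ratCast,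
        Rat.cast_ofNat]
  have hVc : ContinuousOn (fun v : Fin 1 → ℝ => 2 * (ε:ℝ) / ((ε:ℝ) ^ 2 + v 0 ^ 2))
      {u : Fin 1 → ℝ | 0 ≤ u 0 ∧ u 0 ≤ (ε:ℝ)} :=
    (continuous_const.div (by fun_prop) fun u => by positivity).continuousOn
  let V : IntegralRep 1 := contRep _ hVsa isCompact_slab₁.1 _ hVf hVc
  have hinit : ∀ (z : Fin (n + 1) → ℝ), (fun i : Fin n => z (Fin.castAdd 1 i)) = Fin.init z := fun z => rfl
  -- (1) `P₁` is `[D, g] × V` on the nose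
  have h1 : of P₁ - of (sg.prod V) ∈ relations := by
    refine of_sub_of_mem_relations_of_eqOn ?_ fun z hz => ?_
    · rw [IntegralRep.prod_domain, hP₁d]; ext z
      simp only [IntegralRep.mem_prodDomain, hsgd, KZlog.mem_band, hinit]
      rfl
    · rw [hP₁i z hz, IntegralRep.prod_integrand_eq, IntegralRep.prodFun_apply, hinit]
      show _ = sg.integrand (Fin.init z) * (2 * (ε:ℝ) / ((ε:ℝ) ^ 2 + z (Fin.natAdd n 0) ^ 2))
      rw [show (Fin.natAdd _ (0 : Fin 1) : Fin (_ + 1)) = Fin.last _ from Fin.ext (by simp)]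
      ring
  -- (2) `P₂` is `[D, g] × T` after the fibred translation `u ↦ u − g(x)`
  have h2 : of P₂ - of (sg.prod T) ∈ relations := by
    refine of_sub_of_mem_relations_of_fibreMap (m := n) (G := D) (a := fun x => g x - ε) (b := fun x => g x + ε)
      (a' := fun _ => -(ε:ℝ)) (b' := fun _ => (ε:ℝ))
      (fun z => z (Fin.last n) - g (Fin.init z)) (fun _ => 1)
      P₂ (sg.prod T) hP₂d ?_ (fun x _ => by linarith) ?_ ?_ ?_ (fun _ _ => one_pos) ?_ ?_ ?_
    · rw [IntegralRep.prod_domain]; ext z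
      simp only [IntegralRep.mem_prodDomain, hsgd, KZlog.mem_band, hinit]
      rfl
    · have hl : IsSemialgebraicFunOn ℚ P₂.domain (fun z => z (Fin.last n)) :=
        isSemialgebraicFunOn_apply P₂.isSemialgebraic_domain _
      have hgi : IsSemialgebraicFunOn ℚ P₂.domain (fun z => g (Fin.init z)) :=
        hg.comp_init_mono P₂.isSemialgebraic_domain (by rw [hP₂d]; exact KZ.band_subset_setOf_init_mem)
      exact IsSemialgebraicFunOn.sub_holds hl hgi
    · intro z hz
      have hx : Fin.init z ∈ D := by rw [hP₂d] at hz; exact hz.1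
      have hI : DifferentiableAt ℝ (fun w : Fin (n + 1) → ℝ => Fin.init w) z :=
        differentiableAt_pi.mpr fun i => differentiableAt_apply (𝕜 := ℝ) (Fin.castSucc i) z
      exact (differentiableAt_apply (𝕜 := ℝ) (Fin.last n) z).sub ((hgd _ hx).comp z hI)
    · intro z _
      simp only [Fin.snoc_last, Fin.init_snoc]
      exact (hasDerivAt_id' _).sub_const _
    · intro y _
      simp only [Fin.snoc_last, Fin.init_snoc]
      ring
    · intro y _
      simp only [Fin.snoc_last, Fin.init_snoc]
      ring
    · intro z hz
      rw [hP₂i z hz, IntegralRep.prod_integrand_eq, IntegralRep.prodFun_apply, hinit, Fin.init_snoc, mul_one]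
      show _ = sg.integrand (Fin.init z) * ((ε:ℝ) /
        ((Fin.snoc (Fin.init z) (z (Fin.last n) - g (Fin.init z)) : Fin (n + 1) → ℝ) (Fin.natAdd n 0) ^ 2 +
          (ε:ℝ) ^ 2))
      rw [show (Fin.natAdd _ (0 : Fin 1) : Fin (_ + 1)) = Fin.last _ from Fin.ext (by simp), Fin.snoc_last]
      ring
  -- (3) the half winding number and the commutator
  have hTV : of T + of V - of piRep ∈ relations := halfWinding ε hε T V rfl rfl rfl rfl
  have h3 : of sg * (of T + of V - of piRep) ∈ relations := mul_mem_relations_left_holds _ _ hTV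
  have h4 : of sg * of piRep - of piRep * of sg ∈ relations := mul_sub_mul_comm_mem_relations _ _
  have e : of P₁ + of P₂ - of piRep * of sg =
      (of P₁ - of (sg.prod V)) + (of P₂ - of (sg.prod T)) + of sg * (of T + of V - of piRep) +
        (of sg * of piRep - of piRep * of sg) := by
    rw [← of_mul_of, ← of_mul_of, mul_sub, mul_add]
    abel
  rw [e]
  exact add_mem (add_mem (add_mem h1 h2) h3) h4

/-- **`BoxChainE ⟸ GreenReductionE ∧ BoxRescale`** (kernel-checked; uses `poleContributionE`). -/
theorem boxChainE_of (hG : GreenReductionE) (hR : BoxRescale) : BoxChainE := by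
  intro n g U piece F A B lo hi a b c ε hU hsub hg han hlohi hdom hF hFz hB hint hiso
  obtain ⟨P₁, P₂, hP₁d, hP₁i, hP₂d, hP₂i, hmem⟩ :=
    hG n g U piece F A B lo hi a b c ε hU hsub hg han hlohi hdom hF hFz hB hint hiso
  have hε : 0 < ε := hiso.2.1
  have hgτ : IsSemialgebraicFunOn ℚ piece.domain g := hg.mono hsub piece.isSemialgebraic_domain
  have hpole : of P₁ + of P₂ - of piRep * of piece ∈ relations :=
    poleContributionE ε hε g hgτ (fun x hx => (han x (hsub hx)).differentiableAt) piece rfl P₁ P₂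
      hP₁d hP₁i hP₂d hP₂i
  have hle : relations ⊔ AddSubgroup.closure RatBoxSet ≤ relations ⊔ AddSubgroup.closure ratCubeSet :=
    sup_le le_sup_left ((AddSubgroup.closure_le _).2 fun y hy => hR y hy)
  have h := sub_mem (hle hmem) (AddSubgroup.mem_sup_left (T := AddSubgroup.closure ratCubeSet) hpole)
  rwa [sub_sub_cancel] at h

/-- `BoxChainE` HOLDS. -/
theorem boxChainE_holds : BoxChainE := boxChainE_of greenReductionE_holds boxRescale_holds

/-- **The weighted chain on the closed unit cube**: root isolation for the simple root `g` of `D = B·F` on a rational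
grid, the weighted box chain on each sub-box, `[π]`-stability of `relations ⊔ ⟨sector⟩` (item 26388, in tree). -/
theorem etale_cube (hA : RootIsolationE) (hBC : BoxChainE) :
    ∀ (n : ℕ) (g : (Fin n → ℝ) → ℝ) (U : Set (Fin n → ℝ)) (s : IntegralRep n) (F A B : MvPolynomial (Fin (n + 1)) ℚ),
      IsOpen U → Set.pi Set.univ (fun _ : Fin n => Set.Icc (0:ℝ) 1) ⊆ U →
      IsSemialgebraicFunOn ℚ U g → AnalyticOnNhd ℝ g U →
      (∀ x ∈ Set.pi Set.univ (fun _ : Fin n => Set.Icc (0:ℝ) 1), aeval (Fin.snoc x (g x) : Fin (n + 1) → ℝ) F = 0) →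
      (∀ x ∈ Set.pi Set.univ (fun _ : Fin n => Set.Icc (0:ℝ) 1),
        aeval (Fin.snoc x (g x) : Fin (n + 1) → ℝ) (pderiv (Fin.last n) F) ≠ 0) →
      (∀ x ∈ Set.pi Set.univ (fun _ : Fin n => Set.Icc (0:ℝ) 1), aeval (Fin.snoc x (g x) : Fin (n + 1) → ℝ) B ≠ 0) →
      s.domain = Set.pi Set.univ (fun _ : Fin n => Set.Icc (0:ℝ) 1) →
      (∀ x ∈ Set.pi Set.univ (fun _ : Fin n => Set.Icc (0:ℝ) 1),
        s.integrand x = aeval (Fin.snoc x (g x) : Fin (n + 1) → ℝ) A / aeval (Fin.snoc x (g x) : Fin (n + 1) → ℝ) B) →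
      ∀ K : ℕ, 1 ≤ K → (fun x : FormalRep => of piRep * x)^[K] (of s) ∈ relations ⊔ AddSubgroup.closure ratCubeSet := by
  intro n g U s F A B hU hcU hg han hF hFz hB hsd hint K hK
  have hD0 : ∀ x ∈ Set.pi Set.univ (fun _ : Fin n => Set.Icc (0:ℝ) 1),
      aeval (Fin.snoc x (g x) : Fin (n + 1) → ℝ) (B * F) = 0 := fun x hx => by
    rw [map_mul, hF x hx, mul_zero]
  have hDz : ∀ x ∈ Set.pi Set.univ (fun _ : Fin n => Set.Icc (0:ℝ) 1),
      aeval (Fin.snoc x (g x) : Fin (n + 1) → ℝ) (pderiv (Fin.last n) (B * F)) ≠ 0 := fun x hx => by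
    rw [pderiv_mul, map_add, map_mul, map_mul, hF x hx, mul_zero, zero_add]
    exact mul_ne_zero (hB x hx) (hFz x hx)
  obtain ⟨k, lo, hi, piece, a, b, c, ε, hlohi, hdom, hsubc, hpi, hrel, hiso⟩ :=
    hA n g U s (B * F) hU hcU hg han hD0 hDz hsd
  obtain ⟨K', rfl⟩ := Nat.exists_eq_add_of_le hK
  have h1 : of piRep * of s ∈ relations ⊔ AddSubgroup.closure ratCubeSet := by
    have : of piRep * of s =
        of piRep * (of s - ∑ j, of (piece j)) + ∑ j, of piRep * of (piece j) := by
      rw [mul_sub, Finset.mul_sum]; abel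
    rw [this]
    refine add_mem (AddSubgroup.mem_sup_left (piRep_mul_mem_relations hrel))
      (sum_mem fun j _ => ?_)
    exact hBC n g U (piece j) F A B (lo j) (hi j) (a j) (b j) (c j) (ε j) hU ((hsubc j).trans hcU) hg han
      (hlohi j) (hdom j) (fun x hx => hF x (hsubc j hx)) (fun x hx => hFz x (hsubc j hx))
      (fun x hx => hB x (hsubc j hx)) (fun x hx => by rw [hpi j x hx]; exact hint x (hsubc j hx)) (hiso j)
  rw [show 1 + K' = K' + 1 from add_comm _ _, Function.iterate_succ_apply]
  exact piIter_mem_sup Summit.KontsevichZagierPeriods.RootDecompRationalCubeDichotomy.piTimesSector_proof K' h1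

/-- The box map with rational data is the polynomial map `j ↦ loⱼ + dⱼ Xⱼ`. -/
theorem aevalMap_eq_boxMap {m : ℕ} (lo d : Fin m → ℚ) :
    (fun x : Fin m → ℝ => fun j => aeval x (C (lo j) + C (d j) * X j : MvPolynomial (Fin m) ℚ)) =
      boxMap (fun j => (lo j : ℝ)) (fun j => (d j : ℝ)) := by
  funext x; funext j
  simp [boxMap, eq_ratCast]

/-- The affine box map `x ↦ lo + d•x` (coordinatewise) is continuous. -/
theorem continuous_boxMap {m : ℕ} (lo d : Fin m → ℝ) : Continuous (boxMap lo d) :=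
  continuous_pi fun j => continuous_const.add (continuous_const.mul (continuous_apply j))

/-- The affine box map `x ↦ lo + d•x` (coordinatewise) is analytic at every point. -/
theorem analyticAt_boxMap {m : ℕ} (lo d : Fin m → ℝ) (t : Fin m → ℝ) : AnalyticAt ℝ (boxMap lo d) t := by
  rw [boxMap_eq]
  exact analyticAt_const.add ((diagCLM d).analyticAt t)

/-- `x ↦ (x, φ x)` is a `ℚ`-semialgebraic map where `φ` is a `ℚ`-semialgebraic function. [BCR 1998, §2.2] -/
theorem isSemialgebraicMapOn_graphMap {m : ℕ} {s : Set (Fin m → ℝ)} (hs : IsSemialgebraic ℚ s)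
    {φ : (Fin m → ℝ) → ℝ} (hφ : IsSemialgebraicFunOn ℚ s φ) :
    IsSemialgebraicMapOn ℚ s (fun y : Fin m → ℝ => (Fin.snoc y (φ y) : Fin (m + 1) → ℝ)) := by
  refine IsSemialgebraicMapOn.of_forall hs fun j => ?_
  refine Fin.lastCases ?_ (fun i => ?_) j
  · exact hφ.congr (fun y _ => by simp)
  · exact (isSemialgebraicFunOn_apply hs i).congr (fun y _ => by simp)

end Summit.KontsevichZagierPeriods.RootDecompRationalCubeDichotomy.RungEtale.Etale
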